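import Literature.Barriers.AtomisticToContinuum.HalfFillingEnergyProofs
import Literature.Barriers.AtomisticToContinuum.HalfFillingThermalKuboProofs
import HarnessLib

/-!
# Kennedy–Lieb–Shastry / Dyson–Lieb–Simon, XY model at positive temperature: the elementary bounds for every spin

Trunk T-QLATTICE; sibling proof file of `XYOrder.lean` (item
`provefact-Literature.MathematicalPhysics.QuantumLattice.kennedy_lieb_shastry_xy_thermal`). No
statement and no definition is introduced or changed. For the Gibbs state
`⟨·⟩_β = Z⁻¹ tr(· e^{-βH})` of the ferromagnetic quantum XY model `H = xyTorus d L n`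
(`H = -Σ_{⟨xy⟩}(S¹_xS¹_y + S²_xS²_y)`, spin `S = n/2`) on the torus `(ℤ/Lℤ)^d`, this file proves
the finite-dimensional inputs of the positive-temperature Kennedy–Lieb–Shastry argument
([KLS1988PRL] eqs. (3)–(8) run at `T > 0` as in [DLS1978] §5), for EVERY spin:

* `re_gibbsState_xy_corr_symm` — `G^α(x,y) = G^α(y,x)` for the thermal two-point function
  `G^α(x,y) = Re ⟨S^α_x S^α_y⟩_β`;
* `gibbsState_xy_corr_one_eq_zero` — **(Sᵀ)** `⟨S²_xS²_y⟩_β = ⟨S¹_xS¹_y⟩_β` (the global quarter turn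
  about the `3`-axis fixes `H`; Gibbs states are invariant under unitary symmetries);
* `abs_re_gibbsState_xy_corr_le` — **(Tᵀ)** `|G^α(x,y)| ≤ S²` (Löwner bounds `S²·1 ∓ S^α_xS^α_y ≥ 0`);
* `sum_xy_structureFactor_mul_torusCosSum` — **(Cᵀ)** the sum rule [KLS1988PRL] (3), (6) in the raw
  finite-volume form `Σ_q (Σ_{x,y} cos(q·(x-y)) G^α(x,y)) (Σᵢ cos qᵢ) = L^d Σ_x Σᵢ G^α(x, x+eᵢ)`
  (characters of `(ℤ/Lℤ)^d`, any state);
* `xy_pairCorr_lower_thermal` — **(Dᵀ)** the energy bound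
  `e₁ ≥ ½S² - log(n+1)/(2dβ)` for the pair average `e₁ = (dL^d)⁻¹ Σ_x Σᵢ G¹(x, x+eᵢ)`, `L ≥ 3`:
  the product trial state with all spins along the `1`-axis ([KLS1988PRL] after eq. (8)) and the
  energy–entropy bound `⟨H⟩_β ≤ ⟨ψ,Hψ⟩ + log(dim)/β`, `dim = (n+1)^{|Λ|}` (this is DLS's
  hypothesis (a) of Thm. 5.1 with an explicit `D(β)`);
* `xy_kubo_thermal` — **(Bᵀ)** Kubo's inequality `|Σ_x Σᵢ G³(x,x+eᵢ)| ≤ Σ_x Σᵢ G¹(x,x+eᵢ)` on even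
  tori of side `L ≥ 4` ([KLS1988PRL] after eq. (4)), by the Peierls–Bogoliubov inequality for the
  two rotations of the ground-state proof `kubo_xy_bondCorr_abs_le_holds`.

No new definition is made: the thermal objects are written out through `Matrix.gibbsState`. The
spin-`½` versions with a staggered field are the tree's `hc_*_holds`
(`Literature/Barriers/AtomisticToContinuum/HalfFilling*.lean`), whose generic Gibbs-state lemmas
are reused.

## References

* [KLS1988PRL] T. Kennedy, E. H. Lieb, B. S. Shastry, *The XY model has long-range order for all
  spins and all dimensions greater than one*, Phys. Rev. Lett. 61 (1988) 2582–2584, eqs. (3)–(8)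
  (read in: E. H. Lieb, *Statistical Mechanics (Selecta)*, paper IV.8, pp. 327–329).
* [DLS1978] F. J. Dyson, E. H. Lieb, B. Simon, J. Stat. Phys. 18 (1978) 335–383, §2 (sublattice
  rotations), Thm. 5.1 (hypothesis (a): the lower bound `D(β)` on the energy-like quantity).
* [Kubo1988PRL] K. Kubo, Phys. Rev. Lett. 61 (1988) 110.
-/

noncomputable section

open Filter Topology Matrix Finset
open Literature.MathematicalPhysics.QuantumLattice Literature.MathematicalPhysics.QuantumLattice.SpinOperators
  Literature.Probability.LatticeModels Literature.Barriers.AtomisticToContinuum.BoseGas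
open scoped ComplexOrder

namespace Literature.MathematicalPhysics.QuantumLattice

variable {d : ℕ}

/-! ### Symmetry, (Sᵀ) and (Tᵀ) -/

section Elementary

variable (β : ℝ) (L : ℕ) [NeZero L] (n : ℕ)

/-- The thermal two-point function of the XY torus is symmetric:
`Re ⟨S^α_xS^α_y⟩_β = Re ⟨S^α_yS^α_x⟩_β` (`⟨Aᴴ⟩ = conj ⟨A⟩` for the Hermitian Gibbs state and
`(S_xS_y)ᴴ = S_yS_x`). [folklore] -/
theorem re_gibbsState_xy_corr_symm (α : Fin 3) (x y : TorusSite d L) :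
    (gibbsState β (xyTorus d L n) (siteSpin n x α * siteSpin n y α)).re =
      (gibbsState β (xyTorus d L n) (siteSpin n y α * siteSpin n x α)).re := by
  have h : siteSpin n y α * siteSpin n x α = (siteSpin n x α * siteSpin n y α)ᴴ := by
    rw [conjTranspose_mul, (siteSpin_isHermitian n x α).eq, (siteSpin_isHermitian n y α).eq]
  rw [h, gibbsState_conjTranspose β (xyTorus_isHermitian d L n), Complex.star_def, Complex.conj_re]

/-- **(Sᵀ) `1 ↔ 2` symmetry at positive temperature**: `⟨S²_xS²_y⟩_β = ⟨S¹_xS¹_y⟩_β` in the Gibbs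
state of the XY torus, by invariance under the global quarter turn about the `3`-axis
(`U S² Uᴴ = S¹`, `U H Uᴴ = H`). [Kennedy–Lieb–Shastry 1988, "by symmetry" after eq. (3)]
[folklore] -/
theorem gibbsState_xy_corr_one_eq_zero (x y : TorusSite d L) :
    gibbsState β (xyTorus d L n) (siteSpin n x 1 * siteSpin n y 1) =
      gibbsState β (xyTorus d L n) (siteSpin n x 0 * siteSpin n y 0) := by
  set U : Op (TorusSite d L) (n + 1) :=
    productOp (fun _ : TorusSite d L => diagonal fun k : Fin (n + 1) => (-Complex.I) ^ (k : ℕ))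
    with hU
  have hUU : Uᴴ * U = 1 := productOp_conjTranspose_mul fun _ => spinPhase_conjTranspose_mul n
  have hcomm : U * xyTorus d L n = xyTorus d L n * U := by
    have h := quarterTurn_conj_xxzHamiltonian n (torusGraph d L) (-1) 0
    have h2 := congrArg (· * U) h
    simp only at h2
    rw [mul_assoc, hUU, mul_one] at h2
    exact h2
  have hinv := Matrix.gibbsState_conj_of_commute hcomm hUU β (siteSpin n x 1 * siteSpin n y 1)
  rw [productOp_conj_mul (fun _ => spinPhase_conjTranspose_mul n),
    quarterTurn_conj_siteSpin_one, quarterTurn_conj_siteSpin_one] at hinv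
  rw [hinv]

/-- **(Tᵀ) A priori bound** `|Re ⟨S^α_xS^α_y⟩_β| ≤ S²` (`S = n/2`): `S²·1 ∓ S^α_xS^α_y ≥ 0` in the
Löwner order and the Gibbs state is positive and normalised. [folklore] -/
theorem abs_re_gibbsState_xy_corr_le (α : Fin 3) (x y : TorusSite d L) :
    |(gibbsState β (xyTorus d L n) (siteSpin n x α * siteSpin n y α)).re| ≤ ((n : ℝ) / 2) ^ 2 := by
  set H := xyTorus d L n with hH
  have hHerm : H.IsHermitian := xyTorus_isHermitian d L n
  have hone : gibbsState β H 1 = 1 := gibbsState_one β H (partitionFn_pos β hHerm).ne'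
  have hup := gibbsState_nonneg_of_posSemidef β hHerm
    (posSemidef_sq_smul_one_sub_siteSpin_mul' n x y α)
  rw [map_sub, LinearMap.map_smul, hone, smul_eq_mul, mul_one] at hup
  obtain ⟨hup_re, -⟩ := Complex.nonneg_iff.mp hup
  rw [Complex.sub_re, re_half_sq] at hup_re
  have hlo := gibbsState_nonneg_of_posSemidef β hHerm
    (posSemidef_sq_smul_one_add_siteSpin_mul' n x y α)
  rw [map_add, LinearMap.map_smul, hone, smul_eq_mul, mul_one] at hlo
  obtain ⟨hlo_re, -⟩ := Complex.nonneg_iff.mp hlo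
  rw [Complex.add_re, re_half_sq] at hlo_re
  rw [abs_le]
  constructor <;> linarith

/-- Real part of the Gibbs state on a symmetrised bond:
`Re ⟨½(S^α_xS^α_y + S^α_yS^α_x)⟩_β = Re ⟨S^α_xS^α_y⟩_β`. [folklore] -/
theorem re_gibbsState_xy_spinBond (α : Fin 3) (x y : TorusSite d L) :
    (gibbsState β (xyTorus d L n) (spinBond n α x y)).re =
      (gibbsState β (xyTorus d L n) (siteSpin n x α * siteSpin n y α)).re := by
  rw [spinBond, LinearMap.map_smul, map_add, smul_eq_mul,
    show (1 / 2 : ℂ) = ((1 / 2 : ℝ) : ℂ) by push_cast; ring, Complex.re_ofReal_mul,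
    Complex.add_re, re_gibbsState_xy_corr_symm β L n α y x]
  ring

/-- The Gibbs state of the XY torus on an "XXZ-type" bond sum with real weights:
`Re ⟨Σ_E (a b⁰ + b b¹ + c b²)⟩_β = a Σ_E G⁰ + b Σ_E G¹ + c Σ_E G²`. [folklore] -/
theorem re_gibbsState_xy_bondSum (a b c : ℝ) :
    (gibbsState β (xyTorus d L n) (∑ e ∈ (torusGraph d L).edgeFinset,
      Sym2.lift ⟨fun x y => (a : ℂ) • spinBond n 0 x y + (b : ℂ) • spinBond n 1 x y +
        (c : ℂ) • spinBond n 2 x y, fun x y => by simp only [spinBond_comm]⟩ e)).re =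
      a * ∑ e ∈ (torusGraph d L).edgeFinset, Sym2.lift
          ⟨fun x y => (gibbsState β (xyTorus d L n) (siteSpin n x 0 * siteSpin n y 0)).re,
            fun x y => re_gibbsState_xy_corr_symm β L n 0 x y⟩ e +
      b * ∑ e ∈ (torusGraph d L).edgeFinset, Sym2.lift
          ⟨fun x y => (gibbsState β (xyTorus d L n) (siteSpin n x 1 * siteSpin n y 1)).re,
            fun x y => re_gibbsState_xy_corr_symm β L n 1 x y⟩ e +
      c * ∑ e ∈ (torusGraph d L).edgeFinset, Sym2.lift
          ⟨fun x y => (gibbsState β (xyTorus d L n) (siteSpin n x 2 * siteSpin n y 2)).re,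
            fun x y => re_gibbsState_xy_corr_symm β L n 2 x y⟩ e := by
  rw [map_sum, Complex.re_sum, mul_sum, mul_sum, mul_sum, ← sum_add_distrib, ← sum_add_distrib]
  refine sum_congr rfl fun e _ => ?_
  induction e using Sym2.ind with
  | h x y =>
    simp only [Sym2.lift_mk, map_add, LinearMap.map_smul, smul_eq_mul, Complex.add_re,
      Complex.re_ofReal_mul, re_gibbsState_xy_spinBond]

/-- **The thermal energy of the XY torus, edge by edge**: `Re ⟨H⟩_β = -2 Σ_{e ∈ E} G¹(e)` (by (Sᵀ)
`G² = G¹` and the symmetry of `G¹`). [Kennedy–Lieb–Shastry 1988, after eq. (3): "`e₁` is minus half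
the energy per bond"] [folklore] -/
theorem re_gibbsState_xyTorus_self :
    (gibbsState β (xyTorus d L n) (xyTorus d L n)).re =
      -2 * ∑ e ∈ (torusGraph d L).edgeFinset, Sym2.lift
        ⟨fun x y => (gibbsState β (xyTorus d L n) (siteSpin n x 0 * siteSpin n y 0)).re,
          fun x y => re_gibbsState_xy_corr_symm β L n 0 x y⟩ e := by
  have hS : ∀ x y : TorusSite d L,
      (gibbsState β (xyTorus d L n) (siteSpin n x 1 * siteSpin n y 1)).re =
        (gibbsState β (xyTorus d L n) (siteSpin n x 0 * siteSpin n y 0)).re :=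
    fun x y => by rw [gibbsState_xy_corr_one_eq_zero]
  conv_lhs => rw [show gibbsState β (xyTorus d L n) (xyTorus d L n) =
    gibbsState β (xyTorus d L n) (∑ e ∈ (torusGraph d L).edgeFinset,
      Sym2.lift ⟨fun x y => ((-1 : ℝ) : ℂ) • spinBond n 0 x y + ((-1 : ℝ) : ℂ) • spinBond n 1 x y +
        ((0 : ℝ) : ℂ) • spinBond n 2 x y, fun x y => by simp only [spinBond_comm]⟩ e) by
    rw [← xyTorus_eq_bondSum]]
  rw [re_gibbsState_xy_bondSum, mul_sum, mul_sum]
  simp only [zero_mul, add_zero, neg_mul, one_mul, mul_sum, ← sum_add_distrib]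
  refine sum_congr rfl fun e _ => ?_
  induction e using Sym2.ind with
  | h x y =>
    simp only [Sym2.lift_mk, hS]
    ring

end Elementary

/-! ### (Cᵀ) The sum rule -/

section SumRule

variable (β : ℝ) (L : ℕ) [NeZero L] (n : ℕ)

/-- **(Cᵀ) The finite-volume sum rule at positive temperature** ([KLS1988PRL] eqs. (3), (6), raw
Parseval form): for every spin component `α`,
`Σ_q (Σ_{x,y} cos(q·(x-y)) G^α(x,y)) (Σᵢ cos qᵢ) = L^d Σ_x Σᵢ G^α(x, x+eᵢ)`, `G^α = Re⟨S^α_xS^α_y⟩_β`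
(orthogonality of the characters of `(ℤ/Lℤ)^d`, `sum_structureFactor_mul_cos`, and the symmetry
of `G^α`; the state enters only through that symmetry). [cite: KLS1988PRL, eqs. (3), (6)] -/
theorem sum_xy_structureFactor_mul_torusCosSum (α : Fin 3) :
    ∑ q : TorusSite d L, (∑ x : TorusSite d L, ∑ y : TorusSite d L,
        Real.cos (torusPhase L q (x - y)) *
          (gibbsState β (xyTorus d L n) (siteSpin n x α * siteSpin n y α)).re) * torusCosSum L q =
      (L : ℝ) ^ d * ∑ x : TorusSite d L, ∑ i : Fin d,
        (gibbsState β (xyTorus d L n) (siteSpin n x α * siteSpin n (x + Pi.single i 1) α)).re := by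
  calc ∑ q : TorusSite d L, (∑ x : TorusSite d L, ∑ y : TorusSite d L,
        Real.cos (torusPhase L q (x - y)) *
          (gibbsState β (xyTorus d L n) (siteSpin n x α * siteSpin n y α)).re) * torusCosSum L q
      = ∑ q : TorusSite d L, ∑ i : Fin d, (∑ x : TorusSite d L, ∑ y : TorusSite d L,
          Real.cos (torusPhase L q (x - y)) *
            (gibbsState β (xyTorus d L n) (siteSpin n x α * siteSpin n y α)).re) *
          Real.cos (latticeMomentum L q i) := by
        refine sum_congr rfl fun q _ => ?_
        rw [torusCosSum, mul_sum]
    _ = ∑ i : Fin d, ∑ q : TorusSite d L, (∑ x : TorusSite d L, ∑ y : TorusSite d L,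
          Real.cos (torusPhase L q (x - y)) *
            (gibbsState β (xyTorus d L n) (siteSpin n x α * siteSpin n y α)).re) *
          Real.cos (latticeMomentum L q i) := sum_comm
    _ = ∑ i : Fin d, (L : ℝ) ^ d * ∑ x : TorusSite d L,
          (gibbsState β (xyTorus d L n) (siteSpin n x α * siteSpin n (x + Pi.single i 1) α)).re :=
        sum_congr rfl fun i _ => sum_structureFactor_mul_cos L
          (fun x y => (gibbsState β (xyTorus d L n) (siteSpin n x α * siteSpin n y α)).re)
          (re_gibbsState_xy_corr_symm β L n α) i
    _ = _ := by rw [← mul_sum, sum_comm]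

end SumRule

/-! ### (Dᵀ) The energy bound -/

section EnergyBound

/-- **(Dᵀ) The energy bound at positive temperature**, for every spin `S = n/2`: for `d ≥ 1`,
`L ≥ 3`, `β > 0`, the pair average `e₁ = (dL^d)⁻¹ Σ_x Σᵢ Re⟨S¹_xS¹_{x+eᵢ}⟩_β` of the Gibbs state of
the XY torus satisfies `e₁ ≥ ½S² - log(n+1)/(2dβ)`. Proof: `-2dL^d e₁ = Re⟨H⟩_β ≤ ⟨ψ,Hψ⟩ +
log(dim)/β` (energy–entropy bound, `dim = (n+1)^{|Λ|}`) with the product state `ψ` of all spins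
along the `1`-axis, `⟨ψ,Hψ⟩ = -S²|E|`, `|E| = dL^d` ([KLS1988PRL] after eq. (8): "a simple
variational argument … shows `e₁ ≥ ½S²`"; [DLS1978] Thm. 5.1 (a)).
[cite: KLS1988PRL, after eq. (8)] [cite: DysonLiebSimon1978, Thm. 5.1] -/
theorem xy_pairCorr_lower_thermal (hd : 1 ≤ d) (L : ℕ) [NeZero L] (hL : 3 ≤ L) (n : ℕ) {β : ℝ}
    (hβ : 0 < β) :
    ((n : ℝ) / 2) ^ 2 / 2 - Real.log ((n : ℝ) + 1) / (2 * d * β) ≤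
      (∑ x : TorusSite d L, ∑ i : Fin d,
        (gibbsState β (xyTorus d L n) (siteSpin n x 0 * siteSpin n (x + Pi.single i 1) 0)).re) /
        ((d : ℝ) * (L : ℝ) ^ d) := by
  have hL2 : 2 ≤ L := by omega
  have hLne2 : L ≠ 2 := by omega
  have hdpos : (0 : ℝ) < d := by exact_mod_cast (show 0 < d by omega)
  have hLpos : (0 : ℝ) < L := by exact_mod_cast (show 0 < L by omega)
  have hNpos : (0 : ℝ) < (L : ℝ) ^ d := by positivity
  have hHerm : (xyTorus d L n).IsHermitian := xyTorus_isHermitian d L n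
  -- cardinalities: `|Λ| = L^d`, `log dim = |Λ| log (n+1)`, `|E| = d L^d`
  have hcardΛ : (Fintype.card (TorusSite d L) : ℝ) = (L : ℝ) ^ d := by
    rw [Fintype.card_pi, prod_const, ZMod.card, card_univ, Fintype.card_fin]
    push_cast
    ring
  have hlog : Real.log (Fintype.card (TensorIndex (TorusSite d L) (n + 1))) =
      (L : ℝ) ^ d * Real.log ((n : ℝ) + 1) := by
    rw [Fintype.card_pi, prod_const, card_univ, Fintype.card_fin, Nat.cast_pow, Real.log_pow,
      hcardΛ]
    push_cast
    ring
  set g : Sym2 (TorusSite d L) → ℝ :=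
    Sym2.lift ⟨fun x y => (gibbsState β (xyTorus d L n) (siteSpin n x 0 * siteSpin n y 0)).re,
      fun x y => re_gibbsState_xy_corr_symm β L n 0 x y⟩ with hg
  have h4 := sum_pairs_eq_sum_edgeFinset L hL2 g
  have h5 := sum_pairs_eq_sum_edgeFinset (d := d) L hL2 (fun _ => (1 : ℝ))
  rw [if_neg hLne2, one_mul] at h4 h5
  simp only [sum_const, card_univ, nsmul_eq_mul, mul_one, Fintype.card_fin] at h5
  have hEcard : ((torusGraph d L).edgeFinset.card : ℝ) = (d : ℝ) * (L : ℝ) ^ d := by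
    rw [← h5, hcardΛ, mul_comm]
  -- the energy edge by edge
  have hxy := re_gibbsState_xyTorus_self (d := d) β L n
  -- the trial state `ψ = (⨂V)|0…0⟩`
  obtain ⟨V, hV, hV', hVz, -, hVy⟩ := exists_unitary_conj_spinZ_eq_spinX n
  set W : Op (TorusSite d L) (n + 1) := productOp (fun _ : TorusSite d L => Vᴴ) with hW
  have hWW : W * Wᴴ = 1 :=
    productOp_mul_conjTranspose fun _ => by rw [conjTranspose_conjTranspose, hV']
  set v : TensorIndex (TorusSite d L) (n + 1) → ℂ := Pi.single (fun _ => 0) 1 with hv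
  have hstar : star v = v := by rw [hv, ← Pi.single_star, star_one]
  have hψ : star (Wᴴ *ᵥ v) ⬝ᵥ (Wᴴ *ᵥ v) = 1 := by
    rw [star_mulVec, conjTranspose_conjTranspose, ← dotProduct_mulVec, mulVec_mulVec, hWW,
      one_mulVec, hstar, hv, single_dotProduct, Pi.single_eq_same, one_mul]
  have hray : (star (Wᴴ *ᵥ v) ⬝ᵥ xyTorus d L n *ᵥ (Wᴴ *ᵥ v)).re =
      -(((n : ℝ) / 2) ^ 2 * ((d : ℝ) * (L : ℝ) ^ d)) := by
    rw [star_mulVec, conjTranspose_conjTranspose, ← dotProduct_mulVec, mulVec_mulVec,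
      mulVec_mulVec, hstar, hv, single_dotProduct, one_mul, mulVec_single_one, Matrix.col_apply,
      hW, xyTorus_trialEnergy L n hV hV' hVz hVy, Complex.neg_re,
      show (((n : ℂ) / 2) ^ 2 * ((torusGraph d L).edgeFinset.card : ℂ)) =
        ((((n : ℝ) / 2) ^ 2 * ((torusGraph d L).edgeFinset.card : ℝ) : ℝ) : ℂ) by
        push_cast; ring, Complex.ofReal_re, hEcard]
  -- energy–entropy bound against the trial state
  have hee := Matrix.re_gibbsState_hamiltonian_le_rayleigh hHerm hβ (Wᴴ *ᵥ v) hψ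
  rw [hray, hlog, hxy] at hee
  -- pairs versus edges, and the arithmetic
  rw [le_div_iff₀ (by positivity)]
  have hg' : ∀ (x : TorusSite d L) (i : Fin d),
      (gibbsState β (xyTorus d L n) (siteSpin n x 0 * siteSpin n (x + Pi.single i 1) 0)).re =
        g s(x, x + Pi.single i 1) := fun x i => rfl
  simp_rw [hg']
  rw [h4]
  have key : Real.log ((n : ℝ) + 1) / (2 * d * β) * ((d : ℝ) * (L : ℝ) ^ d) =
      (L : ℝ) ^ d * Real.log ((n : ℝ) + 1) / β / 2 := by
    field_simp
  have key2 : ((n : ℝ) / 2) ^ 2 / 2 * ((d : ℝ) * (L : ℝ) ^ d) =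
      ((n : ℝ) / 2) ^ 2 * ((d : ℝ) * (L : ℝ) ^ d) / 2 := by ring
  rw [sub_mul, key, key2]
  linarith

end EnergyBound

/-! ### (Bᵀ) Kubo's inequality at positive temperature -/

section Kubo

/-- **(Bᵀ) Kubo's inequality at positive temperature**, for every spin: on the even torus of side
`L ≥ 4`, for `β > 0`, `|Σ_x Σᵢ G³(x, x+eᵢ)| ≤ Σ_x Σᵢ G¹(x, x+eᵢ)` with `G^α(x,y) = Re⟨S^α_xS^α_y⟩_β`
([KLS1988PRL] after eq. (4): "for otherwise the energy could be lowered by interchanging the 1 and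
3 spin directions"). With `H = -Σ_E(b⁰ + b¹)`, the rotated Hamiltonians `H' = U₁HU₁ᴴ = -Σ_E(b² + b¹)`
(`U₁ = ⨂Vᴴ`, `V S³Vᴴ = S¹`) and `H'' = U₂H'U₂ᴴ = -Σ_E(-b² + b¹)` (`U₂ =` the `π`-rotation about the
`2`-axis on the odd sublattice of the bipartite even torus, [DLS1978] §2) have the partition
function of `H`, so the Peierls–Bogoliubov inequality `⟨UHUᴴ - H⟩_H ≥ 0`
(`Matrix.re_gibbsState_nonneg_of_unitary_conj`) gives `±Σ_E G³ ≤ Σ_E G¹`; pairs `(x,i)` are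
edges for `L ≥ 3`. [cite: KLS1988PRL, after eq. (4)] [cite: Kubo1988PRL]
[cite: DysonLiebSimon1978, §2] -/
theorem xy_kubo_thermal (L : ℕ) [NeZero L] (hL : Even L) (hL4 : 4 ≤ L) (n : ℕ) {β : ℝ}
    (hβ : 0 < β) :
    |∑ x : TorusSite d L, ∑ i : Fin d,
        (gibbsState β (xyTorus d L n) (siteSpin n x 2 * siteSpin n (x + Pi.single i 1) 2)).re| ≤
      ∑ x : TorusSite d L, ∑ i : Fin d,
        (gibbsState β (xyTorus d L n) (siteSpin n x 0 * siteSpin n (x + Pi.single i 1) 0)).re := by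
  obtain ⟨k, rfl⟩ : ∃ k, L = 2 * k := ⟨L / 2, by obtain ⟨k, hk⟩ := hL; omega⟩
  have hL2 : 2 ≤ 2 * k := by omega
  have hLne2 : 2 * k ≠ 2 := by omega
  set L := 2 * k with hLdef
  set E := (torusGraph d L).edgeFinset with hE
  set g : Fin 3 → Sym2 (TorusSite d L) → ℝ := fun α =>
    Sym2.lift ⟨fun x y => (gibbsState β (xyTorus d L n) (siteSpin n x α * siteSpin n y α)).re,
      fun x y => re_gibbsState_xy_corr_symm β L n α x y⟩ with hg
  set H := xyTorus d L n with hH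
  have hHerm : H.IsHermitian := xyTorus_isHermitian d L n
  haveI : Nonempty (TensorIndex (TorusSite d L) (n + 1)) := ⟨fun _ => 0⟩
  -- the bond-sum operators `B(a,b,c) = Σ_E (a b⁰ + b b¹ + c b²)`
  set B : ℝ → ℝ → ℝ → Op (TorusSite d L) (n + 1) := fun a b c =>
    ∑ e ∈ E, Sym2.lift ⟨fun x y => (a : ℂ) • spinBond n 0 x y + (b : ℂ) • spinBond n 1 x y +
      (c : ℂ) • spinBond n 2 x y, fun x y => by simp only [spinBond_comm]⟩ e with hB
  have hωB : ∀ a b c : ℝ, (gibbsState β H (B a b c)).re =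
      a * ∑ e ∈ E, g 0 e + b * ∑ e ∈ E, g 1 e + c * ∑ e ∈ E, g 2 e :=
    fun a b c => re_gibbsState_xy_bondSum β L n a b c
  have hHB : H = B (-1) (-1) 0 := xyTorus_eq_bondSum L n
  -- the single-site rotations
  obtain ⟨V, hV, hV', hVz, hVx, hVy⟩ := exists_unitary_conj_spinZ_eq_spinX n
  have hx : Vᴴ * spinX n * V = SpinOperators.spinZ n := by
    rw [← hVz, ← mul_assoc, ← mul_assoc, hV', one_mul, mul_assoc, hV', mul_one]
  have hy : Vᴴ * spinY n * V = spinY n := by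
    conv_lhs => rw [← hVy]
    rw [← mul_assoc, ← mul_assoc, hV', one_mul, mul_assoc, hV', mul_one]
  set R := V * V with hR
  have hRR : R * Rᴴ = 1 := by
    rw [hR, conjTranspose_mul, mul_assoc, ← mul_assoc V Vᴴ, hV, one_mul, hV]
  have hRR' : Rᴴ * R = 1 := by
    rw [hR, conjTranspose_mul, mul_assoc, ← mul_assoc Vᴴ V, hV', one_mul, hV']
  have hRz : R * SpinOperators.spinZ n * Rᴴ = -SpinOperators.spinZ n := by
    rw [hR, conjTranspose_mul, show V * V * SpinOperators.spinZ n * (Vᴴ * Vᴴ) =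
      V * (V * SpinOperators.spinZ n * Vᴴ) * Vᴴ by simp only [mul_assoc], hVz, hVx]
  have hRy : R * spinY n * Rᴴ = spinY n := by
    rw [hR, conjTranspose_mul, show V * V * spinY n * (Vᴴ * Vᴴ) =
      V * (V * spinY n * Vᴴ) * Vᴴ by simp only [mul_assoc], hVy, hVy]
  -- `U₁ = ⨂ Vᴴ`: `H' = U₁ H U₁ᴴ = B 0 (-1) (-1)`
  set u₁ : TorusSite d L → Matrix (Fin (n + 1)) (Fin (n + 1)) ℂ := fun _ => Vᴴ with hu₁
  have hu₁a : ∀ z, u₁ z * (u₁ z)ᴴ = 1 := fun _ => by rw [hu₁, conjTranspose_conjTranspose, hV']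
  have hu₁b : ∀ z, (u₁ z)ᴴ * u₁ z = 1 := fun _ => by rw [hu₁, conjTranspose_conjTranspose, hV]
  have hb0 : ∀ x y : TorusSite d L,
      productOp u₁ * spinBond n 0 x y * (productOp u₁)ᴴ = spinBond n 2 x y := by
    intro x y
    rw [productOp_conj_spinBond hu₁a hu₁b, spinVec_zero, hu₁]
    simp only [conjTranspose_conjTranspose, hx]
    rfl
  have hb1 : ∀ x y : TorusSite d L,
      productOp u₁ * spinBond n 1 x y * (productOp u₁)ᴴ = spinBond n 1 x y := by
    intro x y
    rw [productOp_conj_spinBond hu₁a hu₁b, spinVec_one, hu₁]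
    simp only [conjTranspose_conjTranspose, hy]
    rfl
  have hH' : productOp u₁ * H * (productOp u₁)ᴴ = B 0 (-1) (-1) := by
    rw [hHB, hB]
    simp only [mul_sum, sum_mul]
    refine sum_congr rfl fun e _ => ?_
    induction e using Sym2.ind with
    | h x y =>
      simp only [Sym2.lift_mk, mul_add, add_mul, mul_smul_comm, smul_mul_assoc, hb0, hb1,
        Complex.ofReal_neg, Complex.ofReal_one, Complex.ofReal_zero, zero_smul, add_zero, zero_add]
      abel
  -- `U₂ = R` on the odd sublattice: `H'' = U₂ H' U₂ᴴ = B 0 (-1) 1`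
  set ε : TorusSite d L → ZMod 2 := fun x =>
    ∑ j, ZMod.castHom (dvd_mul_right 2 k) (ZMod 2) (x j) with hε
  set u₂ : TorusSite d L → Matrix (Fin (n + 1)) (Fin (n + 1)) ℂ :=
    fun z => if ε z = 0 then 1 else R with hu₂
  have hu₂a : ∀ z, u₂ z * (u₂ z)ᴴ = 1 := by
    intro z; simp only [hu₂]; split_ifs
    · rw [conjTranspose_one, mul_one]
    · exact hRR
  have hu₂b : ∀ z, (u₂ z)ᴴ * u₂ z = 1 := by
    intro z; simp only [hu₂]; split_ifs
    · rw [conjTranspose_one, mul_one]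
    · exact hRR'
  set sgn : TorusSite d L → ℂ := fun z => if ε z = 0 then 1 else -1 with hsgn
  have hu₂z : ∀ z, u₂ z * SpinOperators.spinZ n * (u₂ z)ᴴ = sgn z • SpinOperators.spinZ n := by
    intro z; simp only [hu₂, hsgn]; split_ifs
    · rw [conjTranspose_one, mul_one, one_mul, one_smul]
    · rw [hRz, neg_one_smul]
  have hu₂y : ∀ z, u₂ z * spinY n * (u₂ z)ᴴ = spinY n := by
    intro z; simp only [hu₂]; split_ifs
    · rw [conjTranspose_one, mul_one, one_mul]
    · exact hRy
  -- adjacent sites have opposite parity, so `sgn x * sgn y = -1` on edges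
  have hedge : ∀ e ∈ E, ∀ x y, e = s(x, y) → sgn x * sgn y = -1 := by
    intro e he x y hexy
    subst hexy
    rw [hE, SimpleGraph.mem_edgeFinset, SimpleGraph.mem_edgeSet, torusGraph_adj_iff] at he
    have h01 : ∀ t : ZMod 2, t = 0 ∨ t = 1 := by decide
    have key : ∀ x' : TorusSite d L, ∀ i, sgn x' * sgn (x' + Pi.single i 1) = -1 := by
      intro x' i
      have hpar : ε (x' + Pi.single i 1) = ε x' + 1 := torusParity_add_single k x' i
      simp only [hsgn, hpar]
      rcases h01 (ε x') with h0 | h1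
      · rw [if_pos h0, if_neg (by rw [h0]; decide), one_mul]
      · rw [if_neg (by rw [h1]; decide), if_pos (by rw [h1]; decide), mul_one]
    obtain ⟨-, ⟨i, rfl⟩ | ⟨i, rfl⟩⟩ := he
    · exact key x i
    · rw [mul_comm]; exact key y i
  have hc2 : ∀ x y : TorusSite d L, sgn x * sgn y = -1 →
      productOp u₂ * spinBond n 2 x y * (productOp u₂)ᴴ = -spinBond n 2 x y := by
    intro x y hxy
    rw [productOp_conj_spinBond hu₂a hu₂b, spinVec_two, hu₂z, hu₂z, onSite_smul', onSite_smul',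
      smul_mul_smul_comm, smul_mul_smul_comm, mul_comm (sgn y) (sgn x), hxy, spinBond]
    simp only [neg_smul, one_smul]
    rw [← neg_add, smul_neg]
    rfl
  have hc1 : ∀ x y : TorusSite d L,
      productOp u₂ * spinBond n 1 x y * (productOp u₂)ᴴ = spinBond n 1 x y := by
    intro x y
    rw [productOp_conj_spinBond hu₂a hu₂b, spinVec_one, hu₂y, hu₂y, spinBond]
    rfl
  have hH'' : productOp u₂ * B 0 (-1) (-1) * (productOp u₂)ᴴ = B 0 (-1) 1 := by
    rw [hB]
    simp only [mul_sum, sum_mul]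
    refine sum_congr rfl fun e he => ?_
    induction e using Sym2.ind with
    | h x y =>
      have hs := hedge _ he x y rfl
      simp only [Sym2.lift_mk, mul_add, add_mul, Complex.ofReal_neg, Complex.ofReal_one,
        Complex.ofReal_zero, zero_smul, zero_add, neg_smul, one_smul, mul_neg, neg_mul, hc1,
        hc2 x y hs, neg_neg]
  -- the two unitaries and the Peierls–Bogoliubov inequality
  have hU₁ : productOp u₁ ∈ Matrix.unitaryGroup (TensorIndex (TorusSite d L) (n + 1)) ℂ :=
    Matrix.mem_unitaryGroup_iff.2 (productOp_mul_conjTranspose hu₁a)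
  have hU₂ : productOp u₂ ∈ Matrix.unitaryGroup (TensorIndex (TorusSite d L) (n + 1)) ℂ :=
    Matrix.mem_unitaryGroup_iff.2 (productOp_mul_conjTranspose hu₂a)
  have hU₂₁ : productOp u₂ * productOp u₁ ∈
      Matrix.unitaryGroup (TensorIndex (TorusSite d L) (n + 1)) ℂ := mul_mem hU₂ hU₁
  have hHerm' : (B 0 (-1) (-1)).IsHermitian := by
    rw [← hH']; exact isHermitian_mul_mul_conjTranspose _ hHerm
  have hHerm'' : (B 0 (-1) 1).IsHermitian := by
    rw [← hH'']; exact isHermitian_mul_mul_conjTranspose _ hHerm'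
  have hconj₁ : productOp u₁ * H * star (productOp u₁) = H + (B 0 (-1) (-1) - H) := by
    rw [star_eq_conjTranspose, hH']; abel
  have hconj₂ : productOp u₂ * productOp u₁ * H * star (productOp u₂ * productOp u₁) =
      H + (B 0 (-1) 1 - H) := by
    rw [star_eq_conjTranspose, conjTranspose_mul,
      show productOp u₂ * productOp u₁ * H * ((productOp u₁)ᴴ * (productOp u₂)ᴴ) =
        productOp u₂ * (productOp u₁ * H * (productOp u₁)ᴴ) * (productOp u₂)ᴴ by
        simp only [Matrix.mul_assoc], hH', hH'']
    abel
  have hPB₁ := re_gibbsState_nonneg_of_unitary_conj hHerm hβ hU₁ (hHerm'.sub hHerm) hconj₁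
  have hPB₂ := re_gibbsState_nonneg_of_unitary_conj hHerm hβ hU₂₁ (hHerm''.sub hHerm) hconj₂
  have hωH : (gibbsState β H H).re = -(∑ e ∈ E, g 0 e) - ∑ e ∈ E, g 1 e := by
    conv_lhs => rw [show gibbsState β H H = gibbsState β H (B (-1) (-1) 0) by rw [← hHB]]
    rw [hωB]; ring
  rw [map_sub, Complex.sub_re, hωB, hωH] at hPB₁ hPB₂
  -- `|Σ_E G²| ≤ Σ_E G⁰`, then pairs versus edges
  have habs : |∑ e ∈ E, g 2 e| ≤ ∑ e ∈ E, g 0 e := by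
    rw [abs_le]; constructor <;> linarith
  have h0 := sum_pairs_eq_sum_edgeFinset L hL2 (g 0)
  have h2 := sum_pairs_eq_sum_edgeFinset L hL2 (g 2)
  rw [if_neg hLne2, one_mul] at h0 h2
  have hg' : ∀ (α : Fin 3) (x : TorusSite d L) (i : Fin d),
      (gibbsState β H (siteSpin n x α * siteSpin n (x + Pi.single i 1) α)).re =
        g α s(x, x + Pi.single i 1) := fun α x i => rfl
  simp_rw [hg']
  rw [h0, h2]
  exact habs

end Kubo

end Literature.MathematicalPhysics.QuantumLattice
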